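import Mathlib.Analysis.Complex.Liouville
import Literature.NumberTheory.LFunctions.ZetaLogDerivSeries
import Literature.Analysis.SpecialFunctions.GammaRatioStirling
import HarnessLib

/-!
# Route JensenLogBand, BAND crux (stmt-RiemannHypothesis-19913) — infrastructure (I1):
# first-order Stirling for the logarithmic derivative of the Γ-factor of `ξ` (RH-FREE)

Cell rh-jensen, LADDER-RH rung J-P(P3) «log band»; item (I1) of the BAND lead's LINE-PLAN §2/§4
(HOME/rh-jensen-prover/g7-work/LINE-PLAN.md): the model phase `P_x(u) = log γ̃(½+u) + …` of the u-arc
transform needs `λ′ := (log γ̃)′ = ½ Log(s/2π) + E(s)` with `‖E(s)‖ = O(1/|s|)` and `λ″(s) = O(1/|s|)`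
along the arcs (`Im s ≍ |s|` huge, `Re s ≥ 0`). Here `γ̃(s) = s(s-1)/2 · Γℝ(s)` (`ξ = γ̃·ζ`; Mathlib
`Gammaℝ s = π^{-s/2} Γ(s/2)`), so `λ′(s) = 1/s + 1/(s-1) - ½ log π + ½ ψ(s/2)`
(`logDeriv_xiGammaFactor`, the computation inside the tree's `logDeriv_riemannZeta`). We prove

* `norm_xiGammaLogDeriv_sub_half_log_le` — for `Im s > 0`, `Re s > -2m`:
  `‖λ′(s) - ½ Log(s/(2π))‖ ≤ 1/‖s‖ + 1/‖s-1‖ + ½[(π/4+1)/Im(s/2) + (m+1)/Im(s/2)²]`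
  (tree `norm_digamma_sub_log_le_of_im_pos`), and the band form
  `norm_xiGammaLogDeriv_sub_half_log_le_of_re_nonneg`: `≤ 6/Im s` for `Im s ≥ 2`, `Re s ≥ 0`;
* `norm_deriv_digamma_sub_inv_le` — `‖ψ′(w) - 1/w‖ ≤ (π/4+1)/(Im w - 1) + (m+3)/(Im w - 1)²` for
  `Im w ≥ 2`, `Re w ≥ -m` (Cauchy's estimate for `ψ - Log` on the unit circle about `w`);
* `hasDerivAt_xiGammaLogDeriv`, `norm_xiGammaLogDeriv2_sub_le_of_re_nonneg` — `λ″(s) = -1/s² -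
  1/(s-1)² + ¼ ψ′(s/2)` and `‖λ″(s) - 1/(2s)‖ ≤ 6/Im s` for `Im s ≥ 4`, `Re s ≥ 0`.

WHAT THIS IS NOT: estimates for the Γ-factor only — nothing about `ζ`, nothing here bears on zeros of
`ζ` or the truth of RH. (prover-rh-jensen-eng-2-g5-0, 2026-08-27.)
-/

noncomputable section

open Complex Metric Set

set_option linter.dupNamespace false

namespace Summit.RiemannHypothesis.RiemannHypothesis.Theorems.JensenPolynomials.LogBandArc

open Literature.NumberTheory.LFunctions Literature.Analysis.SpecialFunctions.Complex

/-! ## The logarithmic derivative of the Γ-factor -/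

/-- **`λ′(s) = (log γ̃)′(s) = 1/s + 1/(s-1) - ½ log π + ½ ψ(s/2)`** for `γ̃(s) = s(s-1)/2 · Γℝ(s)`,
off `s = 0, 1` and the poles of `Γ(s/2)`. RH-FREE. -/
theorem logDeriv_xiGammaFactor {s : ℂ} (hs0 : s ≠ 0) (hs1 : s ≠ 1) (hpole : ∀ m : ℕ, s / 2 ≠ -m) :
    logDeriv (fun z : ℂ ↦ z * (z - 1) / 2 * Gammaℝ z) s =
      1 / s + 1 / (s - 1) - Complex.log (Real.pi : ℂ) / 2 + Complex.digamma (s / 2) / 2 := by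
  have hΓ : Gammaℝ s ≠ 0 := by
    rw [Ne, Gammaℝ_eq_zero_iff]
    rintro ⟨n, hn⟩
    exact hpole n (by rw [hn]; ring)
  have hdΓ : DifferentiableAt ℂ Gammaℝ s := (RealZeros.hasDerivAt_Gammaℝ hpole).differentiableAt
  have hpoly : logDeriv (fun z : ℂ ↦ z * (z - 1) / 2) s = 1 / s + 1 / (s - 1) := by
    rw [logDeriv_apply]
    have hd : HasDerivAt (fun z : ℂ ↦ z * (z - 1) / 2) ((1 * (s - 1) + s * 1) / 2) s :=
      ((hasDerivAt_id' s).fun_mul ((hasDerivAt_id' s).sub_const 1)).div_const 2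
    rw [hd.deriv]
    have hs1' : s - 1 ≠ 0 := sub_ne_zero.2 hs1
    field_simp
  rw [logDeriv_mul (f := fun z : ℂ ↦ z * (z - 1) / 2) (g := Gammaℝ) s
      (div_ne_zero (mul_ne_zero hs0 (sub_ne_zero.2 hs1)) two_ne_zero) hΓ (by fun_prop) hdΓ,
    hpoly, logDeriv_Gammaℝ hpole]
  ring

/-! ## First-order Stirling for `λ′` -/

/-- `Log(s/(2π)) = Log(s/2) - log π` for `s ≠ 0`. RH-FREE. -/
theorem log_div_two_pi_eq {s : ℂ} (hs0 : s ≠ 0) :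
    Complex.log (s / (2 * Real.pi)) = Complex.log (s / 2) - Real.log Real.pi := by
  have hs2 : s / 2 ≠ 0 := div_ne_zero hs0 two_ne_zero
  have h := Complex.log_mul_ofReal (Real.pi)⁻¹ (inv_pos.2 Real.pi_pos) (s / 2) hs2
  have e : s / 2 * (((Real.pi)⁻¹ : ℝ) : ℂ) = s / (2 * Real.pi) := by
    have hπ : (Real.pi : ℂ) ≠ 0 := by exact_mod_cast Real.pi_ne_zero
    push_cast
    field_simp
  rw [e] at h
  rw [h, Real.log_inv]
  push_cast
  ring

/-- **First-order Stirling for `λ′` (upper half-plane):** for `Im s > 0` and `m : ℕ` with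
`Re(s/2) + m > 0`, `‖λ′(s) - ½ Log(s/(2π))‖ ≤ 1/‖s‖ + 1/‖s-1‖ + ½[(π/4+1)/Im(s/2) + (m+1)/Im(s/2)²]`
(indeed `λ′(s) - ½ Log(s/2π) = 1/s + 1/(s-1) + ½(ψ(s/2) - Log(s/2))`). RH-FREE. -/
theorem norm_xiGammaLogDeriv_sub_half_log_le {s : ℂ} (him : 0 < s.im) (m : ℕ)
    (hre : 0 < (s / 2).re + m) :
    ‖(1 / s + 1 / (s - 1) - Complex.log (Real.pi : ℂ) / 2 + Complex.digamma (s / 2) / 2) -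
        Complex.log (s / (2 * Real.pi)) / 2‖ ≤
      1 / ‖s‖ + 1 / ‖s - 1‖ +
        ((Real.pi / 4 + 1) / (s / 2).im + (m + 1) / (s / 2).im ^ 2) / 2 := by
  have him2 : 0 < (s / 2).im := by
    have : (s / 2).im = s.im / 2 := by simp
    rw [this]; linarith
  have hD := norm_digamma_sub_log_le_of_im_pos him2 m hre
  have hs0 : s ≠ 0 := fun h ↦ by rw [h] at him; simp at him
  have hlogpi : Complex.log (Real.pi : ℂ) = ((Real.log Real.pi : ℝ) : ℂ) :=
    (Complex.ofReal_log Real.pi_pos.le).symm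
  have key : (1 / s + 1 / (s - 1) - Complex.log (Real.pi : ℂ) / 2 + Complex.digamma (s / 2) / 2) -
      Complex.log (s / (2 * Real.pi)) / 2 =
        1 / s + 1 / (s - 1) + (Complex.digamma (s / 2) - Complex.log (s / 2)) / 2 := by
    rw [log_div_two_pi_eq hs0, hlogpi]
    ring
  rw [key]
  calc ‖1 / s + 1 / (s - 1) + (Complex.digamma (s / 2) - Complex.log (s / 2)) / 2‖
      ≤ ‖1 / s‖ + ‖1 / (s - 1)‖ + ‖(Complex.digamma (s / 2) - Complex.log (s / 2)) / 2‖ :=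
        norm_add₃_le
    _ = 1 / ‖s‖ + 1 / ‖s - 1‖ + ‖Complex.digamma (s / 2) - Complex.log (s / 2)‖ / 2 := by
        rw [norm_div, norm_div, norm_div, norm_one, Complex.norm_two]
    _ ≤ _ := by gcongr

/-- **Band form:** for `Im s ≥ 2` and `Re s ≥ 0`, `‖λ′(s) - ½ Log(s/(2π))‖ ≤ 6/Im s`. RH-FREE. -/
theorem norm_xiGammaLogDeriv_sub_half_log_le_of_re_nonneg {s : ℂ} (him : 2 ≤ s.im)
    (hre : 0 ≤ s.re) :
    ‖(1 / s + 1 / (s - 1) - Complex.log (Real.pi : ℂ) / 2 + Complex.digamma (s / 2) / 2) -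
        Complex.log (s / (2 * Real.pi)) / 2‖ ≤ 6 / s.im := by
  have him0 : 0 < s.im := by linarith
  have hre' : 0 < (s / 2).re + (1 : ℕ) := by
    have : (s / 2).re = s.re / 2 := by simp
    rw [this]; push_cast; linarith
  have h := norm_xiGammaLogDeriv_sub_half_log_le him0 1 hre'
  have hims2 : (s / 2).im = s.im / 2 := by simp
  rw [hims2] at h
  -- the three elementary comparisons
  have h1 : 1 / ‖s‖ ≤ 1 / s.im := by
    have : s.im ≤ ‖s‖ := le_trans (le_abs_self _) (Complex.abs_im_le_norm s)
    exact one_div_le_one_div_of_le him0 this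
  have h2 : 1 / ‖s - 1‖ ≤ 1 / s.im := by
    have : s.im ≤ ‖s - 1‖ := by
      have h' := Complex.abs_im_le_norm (s - 1)
      simp only [Complex.sub_im, Complex.one_im, sub_zero] at h'
      exact le_trans (le_abs_self _) h'
    exact one_div_le_one_div_of_le him0 this
  have hX : (Real.pi / 4 + 1) / (s.im / 2) ≤ 4 / s.im := by
    rw [div_le_div_iff₀ (by positivity) him0]
    nlinarith [Real.pi_lt_four]
  have hY : ((1 : ℕ) + 1 : ℝ) / (s.im / 2) ^ 2 ≤ 4 / s.im := by
    push_cast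
    rw [div_le_div_iff₀ (by positivity) him0]
    nlinarith
  have h3 : ((Real.pi / 4 + 1) / (s.im / 2) + ((1 : ℕ) + 1 : ℝ) / (s.im / 2) ^ 2) / 2 ≤ 4 / s.im := by
    linarith
  have e : (6 : ℝ) / s.im = 1 / s.im + 1 / s.im + 4 / s.im := by ring
  rw [e]
  linarith [h, h1, h2, h3]

/-! ## The derivative `λ″` -/

/-- **Cauchy estimate for the trigamma function off the real axis:** for `Im w ≥ 2` and `m : ℕ` with
`Re w ≥ -m`, `‖ψ′(w) - 1/w‖ ≤ (π/4+1)/(Im w - 1) + (m+3)/(Im w - 1)²` (Cauchy's inequality for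
`ψ - Log` on the unit circle about `w`, where `‖ψ - Log‖` is bounded by the tree's first-order
Stirling `norm_digamma_sub_log_le_of_im_pos`). RH-FREE. -/
theorem norm_deriv_digamma_sub_inv_le {w : ℂ} (him : 2 ≤ w.im) (m : ℕ) (hre : -(m : ℝ) ≤ w.re) :
    ‖deriv Complex.digamma w - 1 / w‖ ≤
      (Real.pi / 4 + 1) / (w.im - 1) + ((m : ℝ) + 3) / (w.im - 1) ^ 2 := by
  set g : ℂ → ℂ := fun z ↦ Complex.digamma z - Complex.log z with hg
  have hU : IsOpen {z : ℂ | 0 < z.im} := isOpen_lt continuous_const Complex.continuous_im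
  -- `g` is holomorphic on the upper half-plane
  have hgdiff : DifferentiableOn ℂ g {z : ℂ | 0 < z.im} := by
    refine differentiableOn_digamma_im_pos.sub ?_
    intro z hz
    have hz' : z ∈ Complex.slitPlane := Or.inr (ne_of_gt hz)
    exact (Complex.differentiableAt_log hz').differentiableWithinAt
  -- the closed unit disc about `w` lies in `Im > 0`
  have hsub : closedBall w 1 ⊆ {z : ℂ | 0 < z.im} := by
    intro z hz
    have hz' : ‖z - w‖ ≤ 1 := mem_closedBall_iff_norm.1 hz
    have : |(z - w).im| ≤ 1 := le_trans (Complex.abs_im_le_norm _) hz'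
    rw [Complex.sub_im, abs_le] at this
    show 0 < z.im
    linarith [this.1]
  have hdc : DiffContOnCl ℂ g (ball w 1) := by
    refine DifferentiableOn.diffContOnCl ?_
    rw [closure_ball w one_ne_zero]
    exact hgdiff.mono hsub
  -- bound on the unit circle
  have hC : ∀ z ∈ sphere w 1, ‖g z‖ ≤ (Real.pi / 4 + 1) / (w.im - 1) + ((m : ℝ) + 3) / (w.im - 1) ^ 2 := by
    intro z hz
    have hz' : ‖z - w‖ = 1 := mem_sphere_iff_norm.1 hz
    have hzi : |(z - w).im| ≤ 1 := le_trans (Complex.abs_im_le_norm _) hz'.le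
    have hzr : |(z - w).re| ≤ 1 := le_trans (Complex.abs_re_le_norm _) hz'.le
    rw [Complex.sub_im, abs_le] at hzi
    rw [Complex.sub_re, abs_le] at hzr
    have hzim : w.im - 1 ≤ z.im := by linarith [hzi.1]
    have hzim0 : 0 < z.im := by linarith
    have hzre : 0 < z.re + ((m + 2 : ℕ) : ℝ) := by push_cast; linarith [hzr.1]
    have hb := norm_digamma_sub_log_le_of_im_pos hzim0 (m + 2) hzre
    have hw1 : 0 < w.im - 1 := by linarith
    calc ‖g z‖ = ‖Complex.digamma z - Complex.log z‖ := rfl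
      _ ≤ (Real.pi / 4 + 1) / z.im + (((m + 2 : ℕ) : ℝ) + 1) / z.im ^ 2 := hb
      _ ≤ (Real.pi / 4 + 1) / (w.im - 1) + ((m : ℝ) + 3) / (w.im - 1) ^ 2 := by
          push_cast
          have e : (m : ℝ) + 2 + 1 = (m : ℝ) + 3 := by ring
          rw [e]
          gcongr
  have hest := Complex.norm_deriv_le_of_forall_mem_sphere_norm_le one_pos hdc hC
  rw [div_one] at hest
  -- `deriv g w = ψ′(w) - 1/w`
  have hwim : 0 < w.im := by linarith
  have hw' : w ∈ Complex.slitPlane := Or.inr (ne_of_gt hwim)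
  have hdψ : DifferentiableAt ℂ Complex.digamma w :=
    (differentiableOn_digamma_im_pos w hwim).differentiableAt (hU.mem_nhds hwim)
  have hderiv : deriv g w = deriv Complex.digamma w - 1 / w := by
    have h1 : HasDerivAt g (deriv Complex.digamma w - w⁻¹) w :=
      hdψ.hasDerivAt.sub (Complex.hasDerivAt_log hw')
    rw [h1.deriv, one_div]
  rwa [hderiv] at hest

/-- **`λ″(s)`:** the derivative of `λ′(s) = 1/s + 1/(s-1) - ½ log π + ½ ψ(s/2)` is
`-1/s² - 1/(s-1)² + ¼ ψ′(s/2)`, for `Im s > 0`, `s ≠ 0, 1`. RH-FREE. -/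
theorem hasDerivAt_xiGammaLogDeriv {s : ℂ} (him : 0 < s.im) :
    HasDerivAt (fun z : ℂ ↦ 1 / z + 1 / (z - 1) - Complex.log (Real.pi : ℂ) / 2 +
        Complex.digamma (z / 2) / 2)
      (-1 / s ^ 2 - 1 / (s - 1) ^ 2 + deriv Complex.digamma (s / 2) / 4) s := by
  have hU : IsOpen {z : ℂ | 0 < z.im} := isOpen_lt continuous_const Complex.continuous_im
  have hs0 : s ≠ 0 := fun h ↦ by rw [h] at him; simp at him
  have hs1 : s - 1 ≠ 0 := by
    intro h; have := congrArg Complex.im h; simp at this; linarith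
  have him2 : 0 < (s / 2).im := by
    have : (s / 2).im = s.im / 2 := by simp
    rw [this]; linarith
  have hdψ : DifferentiableAt ℂ Complex.digamma (s / 2) :=
    (differentiableOn_digamma_im_pos (s / 2) him2).differentiableAt (hU.mem_nhds him2)
  have h1 : HasDerivAt (fun z : ℂ ↦ 1 / z) (-1 / s ^ 2) s := by
    have h := hasDerivAt_inv hs0
    have e : (fun z : ℂ ↦ 1 / z) = fun z ↦ z⁻¹ := funext fun z ↦ one_div z
    rw [e, show (-1 : ℂ) / s ^ 2 = -(s ^ 2)⁻¹ by rw [neg_div, one_div]]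
    exact h
  have h2 : HasDerivAt (fun z : ℂ ↦ 1 / (z - 1)) (-1 / (s - 1) ^ 2) s := by
    have h := ((hasDerivAt_id' s).sub_const (1 : ℂ)).inv hs1
    have e : (fun z : ℂ ↦ 1 / (z - 1)) = fun z ↦ (z - 1)⁻¹ := funext fun z ↦ one_div (z - 1)
    rw [e]
    exact h
  have h3 : HasDerivAt (fun z : ℂ ↦ Complex.digamma (z / 2) / 2)
      (deriv Complex.digamma (s / 2) / 4) s := by
    have hlin : HasDerivAt (fun z : ℂ ↦ z / 2) (1 / 2 : ℂ) s := (hasDerivAt_id' s).div_const 2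
    have hc := (hdψ.hasDerivAt.comp s hlin).div_const 2
    exact hc.congr_deriv (by ring)
  have h4 : HasDerivAt (fun _ : ℂ ↦ Complex.log (Real.pi : ℂ) / 2) 0 s := hasDerivAt_const _ _
  exact (((h1.add h2).sub h4).add h3).congr_deriv (by ring)

/-- **Band form for `λ″`:** for `Im s ≥ 4` and `Re s ≥ 0`,
`‖(-1/s² - 1/(s-1)² + ¼ ψ′(s/2)) - 1/(2s)‖ ≤ 6/Im s` (so `λ″(s) = 1/(2s) + O(1/Im s) = O(1/|s|)`).
RH-FREE. -/
theorem norm_xiGammaLogDeriv2_sub_le_of_re_nonneg {s : ℂ} (him : 4 ≤ s.im) (hre : 0 ≤ s.re) :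
    ‖(-1 / s ^ 2 - 1 / (s - 1) ^ 2 + deriv Complex.digamma (s / 2) / 4) - 1 / (2 * s)‖ ≤
      6 / s.im := by
  have him0 : 0 < s.im := by linarith
  have hims2 : (s / 2).im = s.im / 2 := by simp
  have hres2 : (s / 2).re = s.re / 2 := by simp
  have hw : 2 ≤ (s / 2).im := by rw [hims2]; linarith
  have hwre : -((0 : ℕ) : ℝ) ≤ (s / 2).re := by rw [hres2]; push_cast; linarith
  have hψ := norm_deriv_digamma_sub_inv_le hw 0 hwre
  rw [hims2] at hψ
  have hs0 : s ≠ 0 := fun h ↦ by rw [h] at him0; simp at him0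
  -- rewrite the difference
  have key : (-1 / s ^ 2 - 1 / (s - 1) ^ 2 + deriv Complex.digamma (s / 2) / 4) - 1 / (2 * s) =
      -1 / s ^ 2 - 1 / (s - 1) ^ 2 + (deriv Complex.digamma (s / 2) - 1 / (s / 2)) / 4 := by
    field_simp
    ring
  rw [key]
  have hnorm_s : s.im ≤ ‖s‖ := le_trans (le_abs_self _) (Complex.abs_im_le_norm s)
  have hnorm_s1 : s.im ≤ ‖s - 1‖ := by
    have h' := Complex.abs_im_le_norm (s - 1)
    simp only [Complex.sub_im, Complex.one_im, sub_zero] at h'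
    exact le_trans (le_abs_self _) h'
  have hA : ‖-1 / s ^ 2‖ ≤ 1 / s.im ^ 2 := by
    rw [norm_div, norm_neg, norm_one, norm_pow]
    exact one_div_le_one_div_of_le (by positivity) (pow_le_pow_left₀ him0.le hnorm_s 2)
  have hB : ‖1 / (s - 1) ^ 2‖ ≤ 1 / s.im ^ 2 := by
    rw [norm_div, norm_one, norm_pow]
    exact one_div_le_one_div_of_le (by positivity) (pow_le_pow_left₀ him0.le hnorm_s1 2)
  have hC : ‖(deriv Complex.digamma (s / 2) - 1 / (s / 2)) / 4‖ ≤
      ((Real.pi / 4 + 1) / (s.im / 2 - 1) + ((0 : ℕ) + 3 : ℝ) / (s.im / 2 - 1) ^ 2) / 4 := by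
    rw [norm_div, Complex.norm_ofNat]
    gcongr
  have hsum : ‖-1 / s ^ 2 - 1 / (s - 1) ^ 2 + (deriv Complex.digamma (s / 2) - 1 / (s / 2)) / 4‖ ≤
      1 / s.im ^ 2 + 1 / s.im ^ 2 +
        ((Real.pi / 4 + 1) / (s.im / 2 - 1) + ((0 : ℕ) + 3 : ℝ) / (s.im / 2 - 1) ^ 2) / 4 := by
    have h3 := norm_add₃_le (a := -1 / s ^ 2) (b := -(1 / (s - 1) ^ 2))
      (c := (deriv Complex.digamma (s / 2) - 1 / (s / 2)) / 4)
    rw [norm_neg, ← sub_eq_add_neg] at h3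
    exact h3.trans (by gcongr)
  -- numerics: with `t = Im s ≥ 4`, `Im s/2 - 1 ≥ Im s/4`
  have ht : s.im / 2 - 1 ≥ s.im / 4 := by linarith
  have ht0 : 0 < s.im / 2 - 1 := by linarith
  have hπ : Real.pi / 4 + 1 ≤ 2 := by linarith [Real.pi_lt_four]
  have e1 : (Real.pi / 4 + 1) / (s.im / 2 - 1) ≤ 2 / (s.im / 4) := by
    calc (Real.pi / 4 + 1) / (s.im / 2 - 1) ≤ 2 / (s.im / 2 - 1) :=
          div_le_div_of_nonneg_right hπ ht0.le
      _ ≤ 2 / (s.im / 4) := div_le_div_of_nonneg_left (by norm_num) (by positivity) ht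
  have e2 : ((0 : ℕ) + 3 : ℝ) / (s.im / 2 - 1) ^ 2 ≤ 3 / (s.im / 4) ^ 2 := by
    push_cast
    rw [zero_add]
    exact div_le_div_of_nonneg_left (by norm_num) (by positivity) (pow_le_pow_left₀ (by positivity) ht 2)
  have e3 : 1 / s.im ^ 2 ≤ 1 / (4 * s.im) := by
    rw [div_le_div_iff₀ (by positivity) (by positivity)]
    nlinarith
  have e4 : 3 / (s.im / 4) ^ 2 ≤ 12 / s.im := by
    rw [div_le_div_iff₀ (by positivity) him0]
    nlinarith
  have total : 1 / s.im ^ 2 + 1 / s.im ^ 2 +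
      ((Real.pi / 4 + 1) / (s.im / 2 - 1) + ((0 : ℕ) + 3 : ℝ) / (s.im / 2 - 1) ^ 2) / 4 ≤ 6 / s.im := by
    have e1' : 2 / (s.im / 4) = 8 / s.im := by
      rw [div_div_eq_mul_div]; ring
    rw [e1'] at e1
    have e : (6 : ℝ) / s.im = 1 / (4 * s.im) + 1 / (4 * s.im) + (8 / s.im + 12 / s.im) / 4 + (1 / 2) / s.im := by
      field_simp
      ring
    have hpos : 0 ≤ (1 / 2) / s.im := by positivity
    rw [e]
    linarith [e1, e2, e3, e4]
  exact hsum.trans total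

/-! ## The exact antiderivative of the main term (appended 2026-08-27, same seat) -/

/-- **Exact antiderivative of the Stirling main term:** `d/ds ½[s·Log(s/2π) − s] = ½ Log(s/2π)`
for `s/(2π)` in the slit plane (e.g. `Im s > 0`) — the «∫ λ′ ds along the arc» step of the BAND
LINE-PLAN (S4). RH-FREE. (appended 2026-08-27, same seat) -/
theorem hasDerivAt_half_mul_log_sub {s : ℂ} (hs : s / (2 * Real.pi) ∈ Complex.slitPlane) :
    HasDerivAt (fun z : ℂ => (z * Complex.log (z / (2 * Real.pi)) - z) / 2)
      (Complex.log (s / (2 * Real.pi)) / 2) s := by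
  have hπ : (2 * Real.pi : ℂ) ≠ 0 := by
    have : (Real.pi : ℂ) ≠ 0 := by exact_mod_cast Real.pi_ne_zero
    exact mul_ne_zero two_ne_zero this
  have hs0 : s ≠ 0 := by
    intro h; rw [h, zero_div] at hs; exact Complex.slitPlane_ne_zero hs rfl
  have hdiv : HasDerivAt (fun z : ℂ => z / (2 * Real.pi)) (1 / (2 * Real.pi)) s := by
    simpa using (hasDerivAt_id' s).div_const (2 * Real.pi : ℂ)
  have hlog : HasDerivAt (fun z : ℂ => Complex.log (z / (2 * Real.pi))) (1 / s) s := by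
    have h := (Complex.hasDerivAt_log hs).comp s hdiv
    refine h.congr_deriv ?_
    field_simp
  have hmul : HasDerivAt (fun z : ℂ => z * Complex.log (z / (2 * Real.pi)))
      (1 * Complex.log (s / (2 * Real.pi)) + s * (1 / s)) s := (hasDerivAt_id' s).mul hlog
  have hsub := (hmul.sub (hasDerivAt_id' s)).div_const 2
  refine hsub.congr_deriv ?_
  field_simp
  ring

/-- The same on the open upper half-plane: for `Im s > 0`, `s/(2π)` is in the slit plane. RH-FREE. -/
theorem hasDerivAt_half_mul_log_sub_of_im_pos {s : ℂ} (him : 0 < s.im) :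
    HasDerivAt (fun z : ℂ => (z * Complex.log (z / (2 * Real.pi)) - z) / 2)
      (Complex.log (s / (2 * Real.pi)) / 2) s := by
  refine hasDerivAt_half_mul_log_sub (Or.inr ?_)
  have : (s / (2 * Real.pi)).im = s.im / (2 * Real.pi) := by
    rw [show (2 * Real.pi : ℂ) = ((2 * Real.pi : ℝ) : ℂ) by push_cast; ring, Complex.div_ofReal_im]
  rw [this]
  exact (div_pos him (by positivity)).ne'

end Summit.RiemannHypothesis.RiemannHypothesis.Theorems.JensenPolynomials.LogBandArc
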